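import Literature.Analysis.FunctionSpaces.TorusAxisAverageCalculus
import Literature.Analysis.FunctionSpaces.TorusFourierCalculus
import HarnessLib

/-!
# K1loc, line `Spectral` — S-D (first good piece): THE AXIS BLOCK OF THE SPECTRUM IS THE ENERGY OF THE AXIS AVERAGE

Helper file of the prover lane on the crux `K1LocalisedCascade` (stmt-AnomalousDissipation-19491), route
`SawtoothPulseCascade`, registered line `Cruxes.K1LocalisedCascade.Spectral` (one open stub `stub_highModeConcentration`).
Channel (L) of the analytic first good piece (memo v8 §1/§7): the start bad set of the ledger contains the COLUMN `{k : kᵢ = 0}` (the low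
horizontal block at its narrowest), and the tracked energy of the inviscid iterate there is the `L²` norm of its average along the `i`-th
axis — which is what the line-wise estimates (`…OscillatoryChord` + the per-line cell count, memo v8 §7 (L-a)) bound, line by line:

* `mFourierCoeff_axisAvg` — `𝓕(axisAvg i v)(k) = [kᵢ = 0] · 𝓕v(k)` for continuous `v` (Fubini along the measure-preserving shear
  `(x, s) ↦ x + s eᵢ`, `Torus.mFourierCoeff_comp_add_single`, and `Torus.mFourierCoeff_eq_zero_of_forall_add_single`);
* `hasSum_axisBlock` — `Σ_{kᵢ = 0} ‖𝓕v(k)‖² = ∫ ‖axisAvg i v‖²` (Parseval for the smooth axis average);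
* `tsum_axisBlock_real_eq` — for a smooth real `θ`: `Σ' k, [kᵢ = 0]·‖𝓕θ(k)‖² = ∫ (axisAvg i θ)²`, and
  `tsum_axisBlock_real_le` — `≤ ∫ g²` whenever `|axisAvg i θ| ≤ g` pointwise (`g` continuous).

WHAT THIS IS NOT: no statement about the cascade; torus Fourier bookkeeping only.
[cite: Grafakos2014, Prop. 3.1.2 (5) (coefficients of translates) and Prop. 3.2.7 (3) (Parseval)] [problem: turb]
-/

-- `Summit.<Summit>.<Problem>`: single-conjunct summit, the duplicate namespace segment is deliberate.
set_option linter.dupNamespace false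

noncomputable section

namespace Summit.AnomalousDissipation.AnomalousDissipation.Theorems.SawtoothPulseCascade.K1Start

open MeasureTheory Set Filter Topology UnitAddTorus Function
open Literature.Analysis.FunctionSpaces Literature.Analysis.FunctionSpaces.Torus

variable {d : Type*} [Fintype d] [DecidableEq d]

/-! ## §1 Fourier coefficients of the axis average -/

/-- **Fubini for the coefficients of the axis average**: `𝓕(axisAvg i v)(k) = ∫ 𝓕(v(· + s eᵢ))(k) ds` for continuous `v`
(the integrand `e_{−k}(x) v(x + s eᵢ)` is continuous on the compact `T^d × T`, so the two integrals swap). [folklore] -/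
theorem mFourierCoeff_axisAvg_eq_integral {v : UnitAddTorus d → ℂ} (hv : Continuous v) (i : d) (k : d → ℤ) :
    mFourierCoeff (axisAvg i v) k = ∫ s : UnitAddCircle, mFourierCoeff (fun x => v (x + Pi.single i s)) k := by
  simp_rw [mFourierCoeff_eq_integral_volume]
  -- the joint integrand and its integrability
  set f : UnitAddTorus d → UnitAddCircle → ℂ := fun x s => mFourier (-k) x • v (x + Pi.single i s) with hf
  have hcont : Continuous (uncurry f) := by
    refine Continuous.smul ((mFourier (-k)).continuous.comp continuous_fst) (hv.comp ?_)
    exact continuous_fst.add ((continuous_single i).comp continuous_snd)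
  obtain ⟨C, hC⟩ := (isCompact_univ (X := UnitAddTorus d)).exists_bound_of_continuousOn hv.continuousOn
  have hbound : ∀ p : UnitAddTorus d × UnitAddCircle, ‖uncurry f p‖ ≤ C := by
    rintro ⟨x, s⟩
    simp only [uncurry, hf, norm_smul]
    calc ‖mFourier (-k) x‖ * ‖v (x + Pi.single i s)‖ ≤ 1 * C :=
          mul_le_mul (((mFourier (-k)).norm_coe_le_norm x).trans_eq mFourier_norm) (hC _ (mem_univ _))
            (norm_nonneg _) zero_le_one
      _ = C := one_mul C
  have hint : Integrable (uncurry f) ((volume : Measure (UnitAddTorus d)).prod (volume : Measure UnitAddCircle)) :=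
    (integrable_const C).mono' hcont.aestronglyMeasurable (ae_of_all _ hbound)
  have h1 : (fun x => mFourier (-k) x • axisAvg i v x) = fun x => ∫ s, f x s := by
    funext x; rw [axisAvg_apply, ← integral_smul]
  rw [h1, integral_integral_swap hint]

/-- **The axis average keeps exactly the column `kᵢ = 0`**: `𝓕(axisAvg i v)(k) = 𝓕v(k)` if `kᵢ = 0` and `= 0` otherwise (`v` continuous).
[cite: Grafakos2014, Prop. 3.1.2 (5)] -/
theorem mFourierCoeff_axisAvg {v : UnitAddTorus d → ℂ} (hv : Continuous v) (i : d) (k : d → ℤ) :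
    mFourierCoeff (axisAvg i v) k = if k i = 0 then mFourierCoeff v k else 0 := by
  by_cases hk : k i = 0
  · rw [if_pos hk, mFourierCoeff_axisAvg_eq_integral hv i k]
    simp_rw [mFourierCoeff_comp_add_single, hk, fourier_zero, one_smul]
    rw [integral_const, probReal_univ, one_smul]
  · rw [if_neg hk]
    exact mFourierCoeff_eq_zero_of_forall_add_single (axisAvg_add_single i v) hk

/-! ## §2 The energy of the column is the energy of the axis average -/

/-- **Parseval on the column**: for continuous `v` with continuous axis average, `Σ_k [kᵢ = 0]‖𝓕v(k)‖²` sums to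
`∫ ‖axisAvg i v‖²`. [cite: Grafakos2014, Prop. 3.2.7 (3)] -/
theorem hasSum_axisBlock {v : UnitAddTorus d → ℂ} (hv : Continuous v) (i : d) (hA : Continuous (axisAvg i v)) :
    HasSum (fun k : d → ℤ => (if k i = 0 then (1 : ℝ) else 0) * ‖mFourierCoeff v k‖ ^ 2)
      (∫ x, ‖axisAvg i v x‖ ^ 2) := by
  have hP := hasSum_sq_mFourierCoeff_of_continuous hA
  refine hP.congr_fun fun k => ?_
  rw [mFourierCoeff_axisAvg hv i k]
  split_ifs with hk
  · rw [one_mul]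
  · rw [norm_zero, zero_pow two_ne_zero, zero_mul]

/-- **The column energy of a smooth real scalar**: `Σ' k, [kᵢ = 0]·‖𝓕θ(k)‖² = ∫ (axisAvg i θ)²`.
[cite: Grafakos2014, Prop. 3.2.7 (3)] -/
theorem tsum_axisBlock_real_eq {θ : UnitAddTorus d → ℝ} (hθ : IsSmooth θ) (i : d) :
    ∑' k : d → ℤ, (if k i = 0 then (1 : ℝ) else 0) * ‖mFourierCoeff (fun x => (θ x : ℂ)) k‖ ^ 2 =
      ∫ x, (axisAvg i θ x) ^ 2 := by
  have h : ∀ x, axisAvg i (fun x => (θ x : ℂ)) x = ((axisAvg i θ x : ℝ) : ℂ) := fun x => by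
    rw [axisAvg_apply, axisAvg_apply]
    exact integral_ofReal
  have hθc : Continuous (fun x => (θ x : ℂ)) := Complex.continuous_ofReal.comp hθ.continuous
  have hAc : Continuous (axisAvg i (fun x => (θ x : ℂ))) := by
    rw [show axisAvg i (fun x => (θ x : ℂ)) = fun x => ((axisAvg i θ x : ℝ) : ℂ) from funext h]
    exact Complex.continuous_ofReal.comp (hθ.axisAvg i).continuous
  rw [(hasSum_axisBlock hθc i hAc).tsum_eq]
  refine integral_congr_ae (Eventually.of_forall fun x => ?_)
  simp only [h, Complex.norm_real, Real.norm_eq_abs, sq_abs]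

/-- **Column energy from a pointwise bound on the line means**: if `|axisAvg i θ x| ≤ g x` for all `x` with `g` continuous,
then `Σ' k, [kᵢ = 0]·‖𝓕θ(k)‖² ≤ ∫ g²`. [cite: Grafakos2014, Prop. 3.2.7 (3)] -/
theorem tsum_axisBlock_real_le {θ : UnitAddTorus d → ℝ} (hθ : IsSmooth θ) (i : d) {g : UnitAddTorus d → ℝ}
    (hg : Continuous g) (hle : ∀ x, |axisAvg i θ x| ≤ g x) :
    ∑' k : d → ℤ, (if k i = 0 then (1 : ℝ) else 0) * ‖mFourierCoeff (fun x => (θ x : ℂ)) k‖ ^ 2 ≤ ∫ x, g x ^ 2 := by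
  rw [tsum_axisBlock_real_eq hθ i]
  refine integral_mono_of_nonneg (Eventually.of_forall fun x => sq_nonneg _) ((hg.pow 2).integrable_unitAddTorus)
    (Eventually.of_forall fun x => ?_)
  have h := hle x
  show axisAvg i θ x ^ 2 ≤ g x ^ 2
  rw [← sq_abs]
  exact pow_le_pow_left₀ (abs_nonneg _) h 2

end Summit.AnomalousDissipation.AnomalousDissipation.Theorems.SawtoothPulseCascade.K1Start
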